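import Mathlib.Analysis.SpecialFunctions.Log.Deriv
import Mathlib.Analysis.SpecialFunctions.Sqrt
import Mathlib.Analysis.SpecialFunctions.Pow.Real
import Mathlib.Analysis.Calculus.Deriv.Inv
import Mathlib.Analysis.Calculus.Gradient.Basic
import Literature.Analysis.FluidPDE.RadialCalculus
import Literature.Analysis.FluidPDE.SverakLandauClassification
import HarnessLib

/-!
# Šverák's classification of `(−1)`-homogeneous steady Navier–Stokes flows — the endgame

Analysis/FluidPDE support file for the proof of the named fact
`Literature.Analysis.FluidPDE.Sverak2011_landauClassification` (V. Šverák, *On Landau's solutions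
of the Navier–Stokes equations*, J. Math. Sci. 179 (2011) 208–228 = arXiv:math/0604550, Thm. 1),
first file of the series `SverakLandau*`.

Šverák's proof (§4) ends as follows: once the tangential part `v` of the velocity on the unit
sphere is a gradient, `v = ∇φ`, the radial part is `f = 2e^φ − 2` and the conformal factor
`ψ = e^{−φ/2}` is (the restriction to `S²` of) an affine function — in print, "`φ(x) =
−2 log (cosh κ − sinh κ cos θ)`" in a suitable frame, formula (4.6) — the velocity is given by
the Landau formulae (4.7).  This file proves exactly this last, purely algebraic step, in the
`ℝ³ ∖ {0}` rendering used throughout the series (no calculus on the manifold `S²` is available):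
homogeneous functions on `{x | x ≠ 0}` replace functions on the sphere, the potential `Φ` is
`0`-homogeneous with `∇Φ(x) = u(x) − (⟪x, u x⟫/|x|²) x` (the tangential part of `u`), the radial
profile is `F(x) = ⟪x, u(x)⟫` (`= f(x/|x|)`), and "`ψ` affine on `S²`" reads
`e^{−Φ(x)/2} = α + ⟪β, x⟫/|x|` with `α² = 1 + |β|²`, `α > 0` (the normalisation forced by the
Liouville equation (4.4), proved in a later file of the series).

* `Sverak2011.hasFDerivAt_inv_norm` — `D(|·|⁻¹)(x) = −|x|⁻³ ⟪x, ·⟫` for `x ≠ 0`;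
* `Sverak2011.hasFDerivAt_affineConformalFactor` — the derivative of `x ↦ α + ⟪β, x⟫/|x|`;
* `Sverak2011.gradient_potential_of_affine` — if `e^{−Φ/2} = α + ⟪β, ·⟫/|·|` near `x ≠ 0` then
  `∇Φ(x) = −(2/ψ(x)) (β/|x| − (⟪β, x⟫/|x|³) x)`;
* `Sverak2011.landauAxisField_of_affine` — **the endgame**: under the four relations above,
  either `u ≡ 0` on `{x ≠ 0}` (the case `β = 0`) or `u = landauAxisField a c` with the unit axis
  `a = −β/|β|` and `c = α/|β| > 1` (Šverák's `coth κ`; `c² − 1 = 1/|β|²`).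

No new definitions; the statements are phrased with explicit hypotheses so that the final
assembly (`SverakLandauClassificationProofs`) can instantiate them.

## References

* V. Šverák, *On Landau's solutions of the Navier–Stokes equations*, J. Math. Sci. 179 (2011)
  208–228, arXiv:math/0604550, §4, (4.5)–(4.7). [`Sverak2011`]
-/

noncomputable section

open Set Filter
open scoped InnerProductSpace RealInnerProductSpace Topology

namespace Literature.Analysis.FluidPDE

namespace Sverak2011

variable {E : Type*} [NormedAddCommGroup E] [InnerProductSpace ℝ E]

/-- `D(|·|⁻¹)(x) h = −|x|⁻³ ⟪x, h⟫` at `x ≠ 0` (chain rule through `|x|⁻¹ = (√(|x|²))⁻¹`). [folklore] -/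
theorem hasFDerivAt_inv_norm {x : E} (hx : x ≠ 0) :
    HasFDerivAt (fun w : E => ‖w‖⁻¹) ((-(‖x‖⁻¹) ^ 3) • (innerSL ℝ x : E →L[ℝ] ℝ)) x := by
  have hr : 0 < ‖x‖ := norm_pos_iff.mpr hx
  have hr2 : (0 : ℝ) < ‖x‖ ^ 2 := by positivity
  have h1 : HasDerivAt Real.sqrt (1 / (2 * Real.sqrt (‖x‖ ^ 2))) (‖x‖ ^ 2) :=
    Real.hasDerivAt_sqrt hr2.ne'
  have h2 : HasDerivAt (fun s => (Real.sqrt s)⁻¹)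
      (-(1 / (2 * Real.sqrt (‖x‖ ^ 2))) / Real.sqrt (‖x‖ ^ 2) ^ 2) (‖x‖ ^ 2) :=
    h1.inv (by rw [Real.sqrt_sq hr.le]; exact hr.ne')
  have h3 := hasFDerivAt_comp_norm_sq h2
  have hfun : (fun w : E => (Real.sqrt (‖w‖ ^ 2))⁻¹) = fun w => ‖w‖⁻¹ := by
    funext w; rw [Real.sqrt_sq (norm_nonneg w)]
  rw [hfun, Real.sqrt_sq hr.le] at h3
  convert h3 using 2
  field_simp

/-- The derivative of the affine conformal factor `ψ(x) = α + ⟪β, x⟫/|x|` at `x ≠ 0`: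
`Dψ(x) h = ⟪β, h⟫/|x| − ⟪β, x⟫ ⟪x, h⟫/|x|³`. [folklore] -/
theorem hasFDerivAt_affineConformalFactor (α : ℝ) (β : E) {x : E} (hx : x ≠ 0) :
    HasFDerivAt (fun w : E => α + ⟪β, w⟫ * ‖w‖⁻¹)
      (‖x‖⁻¹ • (innerSL ℝ β : E →L[ℝ] ℝ) +
        (⟪β, x⟫ * (-(‖x‖⁻¹) ^ 3)) • (innerSL ℝ x : E →L[ℝ] ℝ)) x := by
  have hi : HasFDerivAt (fun w : E => ⟪β, w⟫) (innerSL ℝ β : E →L[ℝ] ℝ) x :=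
    (innerSL ℝ β : E →L[ℝ] ℝ).hasFDerivAt
  have h : HasFDerivAt (fun w : E => α + ⟪β, w⟫ * ‖w‖⁻¹)
      (⟪β, x⟫ • ((-(‖x‖⁻¹) ^ 3) • (innerSL ℝ x : E →L[ℝ] ℝ)) +
        ‖x‖⁻¹ • (innerSL ℝ β : E →L[ℝ] ℝ)) x :=
    (hi.mul (hasFDerivAt_inv_norm hx)).const_add α
  refine h.congr_fderiv ?_
  ext v
  simp only [FunLike.coe_add, FunLike.coe_smul, Pi.add_apply,
    Pi.smul_apply, innerSL_real_coe_apply_apply, smul_eq_mul]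
  ring

/-- If `e^{−Φ/2} = ψ := α + ⟪β, ·⟫/|·|` on `{x | x ≠ 0}` then, at every `x ≠ 0`,
`Φ = −2 log ψ` near `x` and `∇Φ(x) = −(2/ψ(x)) (β/|x| − (⟪β, x⟫/|x|³) x)` (Šverák 2011, §4: the
tangential velocity `v = ∇φ` recovered from the conformal factor, (4.6)–(4.7)).
[cite: Sverak2011, §4 (4.6)–(4.7)] -/
theorem gradient_potential_of_affine [CompleteSpace E] {Φ : E → ℝ} {α : ℝ} {β : E}
    (hΨ : ∀ x : E, x ≠ 0 → Real.exp (-(Φ x) / 2) = α + ⟪β, x⟫ * ‖x‖⁻¹) {x : E} (hx : x ≠ 0) :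
    gradient Φ x = (-2 * (α + ⟪β, x⟫ * ‖x‖⁻¹)⁻¹) •
      (‖x‖⁻¹ • β + (⟪β, x⟫ * (-(‖x‖⁻¹) ^ 3)) • x) := by
  set ψ : E → ℝ := fun w => α + ⟪β, w⟫ * ‖w‖⁻¹ with hψ
  have hψpos : ∀ w : E, w ≠ 0 → 0 < ψ w := fun w hw => by
    rw [hψ]; dsimp only; rw [← hΨ w hw]; exact Real.exp_pos _
  have hΦeq : ∀ w : E, w ≠ 0 → Φ w = -2 * Real.log (ψ w) := fun w hw => by
    have := congrArg Real.log (hΨ w hw)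
    rw [Real.log_exp] at this
    change -Φ w / 2 = Real.log (ψ w) at this
    linarith
  have hev : Φ =ᶠ[𝓝 x] fun w => -2 * Real.log (ψ w) := by
    filter_upwards [isOpen_compl_singleton.mem_nhds hx] with w hw
    exact hΦeq w hw
  have hD : HasFDerivAt (fun w => -2 * Real.log (ψ w))
      ((-2 : ℝ) • ((ψ x)⁻¹ • (‖x‖⁻¹ • (innerSL ℝ β : E →L[ℝ] ℝ) +
        (⟪β, x⟫ * (-(‖x‖⁻¹) ^ 3)) • (innerSL ℝ x : E →L[ℝ] ℝ)))) x :=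
    (((hasFDerivAt_affineConformalFactor α β hx).log (hψpos x hx).ne')).const_mul (-2)
  have hDΦ : HasFDerivAt Φ _ x := hD.congr_of_eventuallyEq hev
  apply ext_inner_right ℝ
  intro h
  rw [inner_gradient_left, hDΦ.fderiv]
  simp only [FunLike.coe_add, FunLike.coe_smul, Pi.add_apply,
    Pi.smul_apply, innerSL_real_coe_apply_apply, smul_eq_mul, inner_smul_left, inner_add_left,
    RCLike.conj_to_real]
  simp only [hψ]
  ring

/-- **The endgame of Šverák's proof** (Šverák 2011, §4, from (4.5)–(4.6) to (4.7)), `ℝ³ ∖ {0}`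
rendering (`ℝ³ = EuclideanSpace ℝ (Fin 3)`).  Let `u : ℝ³ → ℝ³` and a potential `Φ` satisfy, at
every `x ≠ 0`:
`∇Φ(x) = u(x) − (⟪x, u x⟫/|x|²) x` (the tangential part of `u` is the gradient of the
`0`-homogeneous `Φ`), `2 + ⟪x, u(x)⟫ = 2e^{Φ(x)}` (the radial profile is `f = 2e^φ − 2`, (4.7)₂),
and `e^{−Φ(x)/2} = α + ⟪β, x⟫/|x|` with `α² = 1 + |β|²`, `α > 0` (the conformal factor
`e^{−φ/2}` is affine, (4.6): `cosh κ − sinh κ cos θ`).  Then either `u ≡ 0` on `{x ≠ 0}`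
(`β = 0`), or `u = landauAxisField a c` there, with unit axis `a = −β/|β|` and
`c = α/|β| > 1` — Landau's solution (4.7) with `c = coth κ`. [cite: Sverak2011, §4 (4.6)–(4.7)] -/
theorem landauAxisField_of_affine {u : EuclideanSpace ℝ (Fin 3) → EuclideanSpace ℝ (Fin 3)}
    {Φ : EuclideanSpace ℝ (Fin 3) → ℝ} {α : ℝ} {β : EuclideanSpace ℝ (Fin 3)}
    (hgrad : ∀ x, x ≠ 0 → gradient Φ x = u x - (⟪x, u x⟫ / ‖x‖ ^ 2) • x)
    (hF : ∀ x, x ≠ 0 → 2 + ⟪x, u x⟫ = 2 * Real.exp (Φ x))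
    (hαβ : α ^ 2 = 1 + ‖β‖ ^ 2) (hα : 0 < α)
    (hΨ : ∀ x, x ≠ 0 → Real.exp (-(Φ x) / 2) = α + ⟪β, x⟫ * ‖x‖⁻¹) :
    (∀ x, x ≠ 0 → u x = 0) ∨
      ∃ a : EuclideanSpace ℝ (Fin 3), ‖a‖ = 1 ∧ ∃ c : ℝ, 1 < c ∧
        ∀ x, x ≠ 0 → u x = landauAxisField a c x := by
  -- the velocity in terms of `α`, `β`
  have hu : ∀ x : EuclideanSpace ℝ (Fin 3), x ≠ 0 → u x =
      (-2 * (α + ⟪β, x⟫ * ‖x‖⁻¹)⁻¹) • (‖x‖⁻¹ • β + (⟪β, x⟫ * (-(‖x‖⁻¹) ^ 3)) • x) +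
        ((2 * ((α + ⟪β, x⟫ * ‖x‖⁻¹) ^ 2)⁻¹ - 2) / ‖x‖ ^ 2) • x := by
    intro x hx
    have h1 := hgrad x hx
    rw [gradient_potential_of_affine hΨ hx] at h1
    have h2 : ⟪x, u x⟫ = 2 * ((α + ⟪β, x⟫ * ‖x‖⁻¹) ^ 2)⁻¹ - 2 := by
      have h3 := hF x hx
      have h4 : Real.exp (Φ x) = ((α + ⟪β, x⟫ * ‖x‖⁻¹) ^ 2)⁻¹ := by
        rw [← hΨ x hx, ← Real.exp_nat_mul, ← Real.exp_neg]
        congr 1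
        push_cast
        ring
      rw [h4] at h3
      linarith
    rw [← h2, h1]
    abel
  by_cases hβ : β = 0
  · -- `β = 0`: then `α = 1`, the conformal factor is `1` and `u ≡ 0`
    left
    intro x hx
    have hα1 : α = 1 := by
      rw [hβ, norm_zero] at hαβ
      nlinarith
    rw [hu x hx, hβ, hα1]
    simp
  · right
    have hb : 0 < ‖β‖ := norm_pos_iff.mpr hβ
    have hαb : ‖β‖ < α := by nlinarith
    refine ⟨(-(‖β‖⁻¹)) • β, ?_, α / ‖β‖, ?_, fun x hx => ?_⟩
    · rw [norm_smul, norm_neg, norm_inv, norm_norm, inv_mul_cancel₀ hb.ne']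
    · rwa [one_lt_div hb]
    have hr : 0 < ‖x‖ := norm_pos_iff.mpr hx
    -- positivity of the conformal factor
    have hψ : 0 < α + ⟪β, x⟫ * ‖x‖⁻¹ := by rw [← hΨ x hx]; exact Real.exp_pos _
    have hψ' : 0 < α * ‖x‖ + ⟪β, x⟫ := by
      have := mul_pos hψ hr
      rwa [add_mul, mul_assoc, inv_mul_cancel₀ hr.ne', mul_one] at this
    rw [hu x hx, landauAxisField]
    simp only [inner_smul_left, RCLike.conj_to_real]
    set r : ℝ := ‖x‖ with hr_def
    set s : ℝ := ⟪β, x⟫ with hs_def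
    set b : ℝ := ‖β‖ with hb_def
    have hden : α / b * r - -b⁻¹ * s = (α * r + s) / b := by
      field_simp
      ring
    rw [hden]
    have hc2 : (α / b) ^ 2 - 1 = (b ^ 2)⁻¹ := by
      field_simp
      linarith
    rw [hc2]
    match_scalars
    · field_simp
    · field_simp
      ring

end Sverak2011

end Literature.Analysis.FluidPDE
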